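import Summits.HubbardSuperconductivity.HubbardSuperconductivity.Theorems.BalabanIRBirComplexStableXYFixedVolumeCoercive
import Summits.HubbardSuperconductivity.HubbardSuperconductivity.Theorems.BalabanIRBirComplexStableXYFixedVolumeAction
import Summits.HubbardSuperconductivity.HubbardSuperconductivity.Theorems.BirComplexStableXY.Negative.WitnessTable
import HarnessLib

/-!
# Uniform local equipartition, part 3: small fields cost little, and the small-ball LOWER bound on the
# modulus partition function

Support file for crux `BirComplexStableXYR` (stmt-HubbardSuperconductivity-14845), line
`log-concave-core-bounded-phase`, stub `stub_uniformEquipartition` (line lead a2).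

For a window table with (U1) (charge-neutral support) and (N) (`Σ c_n = 0`):

* `ule_re_action_le_of_small` — if `|θ_i| ≤ ρ` everywhere then `Re Σ_s F(θ∘sh s) ≤ 3·normA(c)·ρ²·|Λ|`:
  the constant and linear Taylor terms vanish after summing over translates (by (N) and (U1): the
  translate sum of `n·(θ∘sh s)` is `(Σ_w n_w)(Σ_p θ_p) = 0`), and the remainder is controlled by the
  global bound `‖e^{ix} − 1 − ix‖ ≤ (3/2)x²` and `|n|₁² ≤ 2e^{|n|₁}`;
* `ule_partZ_lower` — for `normA ≤ B`, `Re F ≥ 0` and `K ≥ 1`: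
  `2π·(2K^{-1/2})^{|Λ|−1}·exp(−3·max(B,0)·|Λ|) ≤ ∫_{[0,2π]^Λ} exp(−K Σ_s Re F(θ∘sh s)) dθ`
  (pin the global rotation with `birFixedVolume_cube_to_shear`, restrict to the box `|δ_i| ≤ K^{-1/2}`).

`ule_partZ_lowerBound` is the binder-free registered form. [folklore]
-/

noncomputable section

namespace Summit.HubbardSuperconductivity.HubbardSuperconductivity.Theorems

open MeasureTheory Set

/-! ### Small fields cost little: `K·Re Σ_s F_s(θ) ≤ 3·normA·|Λ|` when `‖θ‖_∞ ≤ K^{-1/2}` -/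

section Lower

open Summit.HubbardSuperconductivity.BirComplexStableXYNegative Literature.Probability.LatticeModels

variable {r : ℕ}

/-- Global quadratic Taylor bound for the character: `‖e^{ix} − 1 − ix‖ ≤ (3/2)x²` for real `x`
(`|cos x − 1| ≤ x²/2`, `|sin x − x| ≤ min(|x|³/6, |x| + 1) ≤ x²`). [folklore] -/
theorem ule_norm_cexp_sub_one_sub_le (x : ℝ) :
    ‖Complex.exp (Complex.I * (x : ℂ)) - 1 - Complex.I * (x : ℂ)‖ ≤ 3 / 2 * x ^ 2 := by
  set R := Complex.exp (Complex.I * (x : ℂ)) - 1 - Complex.I * (x : ℂ) with hR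
  have hre : R.re = Real.cos x - 1 := by
    rw [hR, Complex.sub_re, Complex.sub_re, mul_comm, Complex.exp_mul_I]
    simp [Complex.cos_ofReal_re, Complex.sin_ofReal_re, Complex.sin_ofReal_im]
  have him : R.im = Real.sin x - x := by
    rw [hR, Complex.sub_im, Complex.sub_im, mul_comm, Complex.exp_mul_I]
    simp [Complex.sin_ofReal_re, Complex.cos_ofReal_im, Complex.sin_ofReal_im]
  have h1 : |R.re| ≤ x ^ 2 / 2 := by
    rw [hre, abs_sub_comm, abs_of_nonneg (sub_nonneg.2 (Real.cos_le_one x))]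
    linarith [Real.one_sub_sq_div_two_le_cos (x := x)]
  have h2 : |R.im| ≤ x ^ 2 := by
    rw [him, abs_sub_comm]
    have h3 := Real.abs_sub_sin_le x
    rcases le_or_gt |x| 6 with h6 | h6
    · calc |x - Real.sin x| ≤ |x| ^ 3 / 6 := h3
        _ = |x| * |x| ^ 2 / 6 := by ring
        _ ≤ 6 * |x| ^ 2 / 6 := by gcongr
        _ = x ^ 2 := by rw [sq_abs]; ring
    · have hs := Real.abs_sin_le_one x
      calc |x - Real.sin x| ≤ |x| + |Real.sin x| := abs_sub _ _
        _ ≤ |x| + 1 := by linarith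
        _ ≤ |x| * |x| := by nlinarith
        _ = x ^ 2 := by rw [← sq, sq_abs]
  calc ‖R‖ ≤ |R.re| + |R.im| := Complex.norm_le_abs_re_add_abs_im R
    _ ≤ x ^ 2 / 2 + x ^ 2 := add_le_add h1 h2
    _ = 3 / 2 * x ^ 2 := by ring

/-- `t² ≤ 2 e^t` for `t ≥ 0`. [folklore] -/
theorem ule_sq_le_two_mul_exp {t : ℝ} (ht : 0 ≤ t) : t ^ 2 ≤ 2 * Real.exp t := by
  have := Real.quadratic_le_exp_of_nonneg ht
  nlinarith [Real.exp_pos t]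

/-- The pairing of an integer frequency with a sup-small configuration: `|n·φ| ≤ |n|₁·ρ` if
`|φ_w| ≤ ρ` for all `w`. [folklore] -/
theorem ule_abs_frq_le_of_sup (n : Freq r) (φ : W r → ℝ) {ρ : ℝ} (hφ : ∀ w, |φ w| ≤ ρ) :
    |∑ w, (n w : ℝ) * φ w| ≤ (∑ w, |(n w : ℝ)|) * ρ := by
  calc |∑ w, (n w : ℝ) * φ w| ≤ ∑ w, |(n w : ℝ) * φ w| := Finset.abs_sum_le_sum_abs _ _
    _ = ∑ w, |(n w : ℝ)| * |φ w| := by simp_rw [abs_mul]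
    _ ≤ ∑ w, |(n w : ℝ)| * ρ := Finset.sum_le_sum fun w _ =>
        mul_le_mul_of_nonneg_left (hφ w) (abs_nonneg _)
    _ = (∑ w, |(n w : ℝ)|) * ρ := by rw [Finset.sum_mul]

/-- **Small fields cost little.**  For a table with (U1) and (N) and any torus field with
`|θ_i| ≤ ρ` everywhere, `Re Σ_s F(θ∘sh s) ≤ 3·normA(c)·ρ²·|Λ|`: after subtracting the constant and
linear Taylor terms — which vanish when summed over translates, by (N) and (U1) — each window
contributes `≤ Σ_n |c_n|·(3/2)(n·ψ)² ≤ 3ρ²·Σ_n|c_n|e^{|n|₁}`. [folklore] -/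
theorem ule_re_action_le_of_small (c : Table r) (hU1 : ∀ n ∈ c.support, ∑ w, n w = 0)
    (hN : c.sum (fun _ a => a) = 0) (L M : ℕ) [NeZero L] [NeZero M]
    (θ : Λ L M → ℝ) {ρ : ℝ} (hθ : ∀ i, |θ i| ≤ ρ) :
    (∑ s : Λ L M, genF c (fun w => θ (sh L M s w))).re ≤
      3 * normA c * ρ ^ 2 * Fintype.card (Λ L M) := by
  classical
  -- the constant and linear Taylor terms vanish after summing over translates
  have hsh : ∀ (s : Λ L M) (w : W r), sh L M s w =
      s + (![((w.1 : ℕ) : ZMod L), ((w.2.1 : ℕ) : ZMod L)], ((w.2.2 : ℕ) : ZMod M)) := fun s w => rfl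
  have hswap : ∀ w : W r, ∑ s : Λ L M, θ (sh L M s w) = ∑ p : Λ L M, θ p := by
    intro w
    simp only [hsh]
    exact Fintype.sum_equiv (Equiv.addRight _) _ _ fun s => rfl
  have hlin : ∑ s : Λ L M, ∑ n ∈ c.support, c n * (Complex.I * ((∑ w, (n w : ℝ) * θ (sh L M s w) : ℝ) : ℂ)) = 0 := by
    rw [Finset.sum_comm]
    refine Finset.sum_eq_zero fun n hn => ?_
    rw [← Finset.mul_sum, ← Finset.mul_sum]
    have key : ∑ s : Λ L M, ((∑ w, (n w : ℝ) * θ (sh L M s w) : ℝ) : ℂ) = 0 := by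
      rw [← Complex.ofReal_sum, Finset.sum_comm]
      have h2 : ∑ w : W r, ∑ s : Λ L M, (n w : ℝ) * θ (sh L M s w) =
          (∑ w : W r, (n w : ℝ)) * ∑ p : Λ L M, θ p := by
        rw [Finset.sum_mul]
        refine Finset.sum_congr rfl fun w _ => ?_
        rw [← Finset.mul_sum, hswap]
      rw [h2]
      have h3 : ∑ w : W r, (n w : ℝ) = 0 := by exact_mod_cast hU1 n hn
      rw [h3, zero_mul, Complex.ofReal_zero]
    rw [key, mul_zero, mul_zero]
  have hconst : ∑ _s : Λ L M, ∑ n ∈ c.support, c n = 0 := by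
    have : ∑ n ∈ c.support, c n = 0 := hN
    rw [this, Finset.sum_const_zero]
  -- regroup the action
  have hreg : ∑ s : Λ L M, genF c (fun w => θ (sh L M s w)) =
      ∑ s : Λ L M, ∑ n ∈ c.support, c n *
        (Complex.exp (Complex.I * ((∑ w, (n w : ℝ) * θ (sh L M s w) : ℝ) : ℂ)) - 1 -
          Complex.I * ((∑ w, (n w : ℝ) * θ (sh L M s w) : ℝ) : ℂ)) := by
    have h1 : ∑ s : Λ L M, genF c (fun w => θ (sh L M s w)) =
        ∑ s : Λ L M, ∑ n ∈ c.support, c n *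
          Complex.exp (Complex.I * ((∑ w, (n w : ℝ) * θ (sh L M s w) : ℝ) : ℂ)) := by
      rfl
    rw [h1]
    have h2 : ∑ s : Λ L M, ∑ n ∈ c.support, c n *
        (Complex.exp (Complex.I * ((∑ w, (n w : ℝ) * θ (sh L M s w) : ℝ) : ℂ)) - 1 -
          Complex.I * ((∑ w, (n w : ℝ) * θ (sh L M s w) : ℝ) : ℂ)) =
        ∑ s : Λ L M, ∑ n ∈ c.support, c n *
          Complex.exp (Complex.I * ((∑ w, (n w : ℝ) * θ (sh L M s w) : ℝ) : ℂ)) -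
        ∑ _s : Λ L M, ∑ n ∈ c.support, c n -
        ∑ s : Λ L M, ∑ n ∈ c.support, c n * (Complex.I * ((∑ w, (n w : ℝ) * θ (sh L M s w) : ℝ) : ℂ)) := by
      rw [← Finset.sum_sub_distrib, ← Finset.sum_sub_distrib]
      refine Finset.sum_congr rfl fun s _ => ?_
      rw [← Finset.sum_sub_distrib, ← Finset.sum_sub_distrib]
      refine Finset.sum_congr rfl fun n _ => ?_
      ring
    rw [h2, hlin, hconst, sub_zero, sub_zero]
  -- bound the regrouped sum term by term
  rw [hreg, Complex.re_sum]
  have hterm : ∀ s : Λ L M, (∑ n ∈ c.support, c n *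
      (Complex.exp (Complex.I * ((∑ w, (n w : ℝ) * θ (sh L M s w) : ℝ) : ℂ)) - 1 -
        Complex.I * ((∑ w, (n w : ℝ) * θ (sh L M s w) : ℝ) : ℂ))).re ≤ 3 * normA c * ρ ^ 2 := by
    intro s
    refine (Complex.re_le_norm _).trans ((norm_sum_le _ _).trans ?_)
    have hA : normA c = ∑ n ∈ c.support, ‖c n‖ * Real.exp (∑ w, |(n w : ℝ)|) := rfl
    rw [hA, Finset.mul_sum, Finset.sum_mul]
    refine Finset.sum_le_sum fun n hn => ?_
    rw [norm_mul]
    set x : ℝ := ∑ w, (n w : ℝ) * θ (sh L M s w) with hx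
    have hxb : |x| ≤ (∑ w, |(n w : ℝ)|) * ρ := ule_abs_frq_le_of_sup n _ fun w => hθ _
    have hn1 : 0 ≤ ∑ w, |(n w : ℝ)| := Finset.sum_nonneg fun w _ => abs_nonneg _
    have hρ : 0 ≤ ρ := le_trans (abs_nonneg _) (hθ 0)
    have hx2 : x ^ 2 ≤ (∑ w, |(n w : ℝ)|) ^ 2 * ρ ^ 2 := by
      rw [← mul_pow, ← sq_abs]
      exact pow_le_pow_left₀ (abs_nonneg x) hxb 2
    have hsq := ule_sq_le_two_mul_exp hn1
    calc ‖c n‖ * ‖Complex.exp (Complex.I * (x : ℂ)) - 1 - Complex.I * (x : ℂ)‖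
        ≤ ‖c n‖ * (3 / 2 * x ^ 2) :=
          mul_le_mul_of_nonneg_left (ule_norm_cexp_sub_one_sub_le x) (norm_nonneg _)
      _ ≤ ‖c n‖ * (3 / 2 * ((∑ w, |(n w : ℝ)|) ^ 2 * ρ ^ 2)) := by gcongr
      _ ≤ ‖c n‖ * (3 / 2 * (2 * Real.exp (∑ w, |(n w : ℝ)|) * ρ ^ 2)) := by gcongr
      _ = 3 * (‖c n‖ * Real.exp (∑ w, |(n w : ℝ)|)) * ρ ^ 2 := by ring
  calc ∑ s : Λ L M, (∑ n ∈ c.support, c n *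
        (Complex.exp (Complex.I * ((∑ w, (n w : ℝ) * θ (sh L M s w) : ℝ) : ℂ)) - 1 -
          Complex.I * ((∑ w, (n w : ℝ) * θ (sh L M s w) : ℝ) : ℂ))).re
      ≤ ∑ _s : Λ L M, 3 * normA c * ρ ^ 2 := Finset.sum_le_sum fun s _ => hterm s
    _ = 3 * normA c * ρ ^ 2 * Fintype.card (Λ L M) := by
        rw [Finset.sum_const, Finset.card_univ, nsmul_eq_mul]; ring

/-- **Small-ball lower bound on the modulus partition function.**  For a table with (U1), (N),
`normA ≤ B` and `K ≥ 1`: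
`2π·(2K^{-1/2})^{|Λ|−1}·exp(−3·max(B,0)·|Λ|) ≤ ∫_cube exp(−K Σ_s Re F(θ∘sh s)) dθ`
(pin the rotation with `birFixedVolume_cube_to_shear`, restrict to the box `|δ_i| ≤ K^{-1/2}` and use
`ule_re_action_le_of_small`). [folklore] -/
theorem ule_partZ_lower (c : Table r) (hU1 : ∀ n ∈ c.support, ∑ w, n w = 0)
    (hN : c.sum (fun _ a => a) = 0) {B : ℝ} (hA : normA c ≤ B)
    (hC0 : ∀ φ : W r → ℝ, 0 ≤ (genF c φ).re) {K : ℝ} (hK : 1 ≤ K)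
    (L M : ℕ) [NeZero L] [NeZero M] :
    2 * Real.pi * (2 * (Real.sqrt K)⁻¹) ^ (Fintype.card (Λ L M) - 1) *
        Real.exp (-(3 * max B 0 * Fintype.card (Λ L M))) ≤
      ∫ θ in cube L M, Real.exp (-(K * ∑ s : Λ L M, (genF c (fun w => θ (sh L M s w))).re)) := by
  classical
  have hK0 : 0 < K := by linarith
  set H : (Λ L M → ℝ) → ℝ := fun θ => ∑ s : Λ L M, (genF c (fun w => θ (sh L M s w))).re with hH
  show _ ≤ ∫ θ in cube L M, Real.exp (-(K * H θ))
  have hH0 : ∀ θ, 0 ≤ H θ := fun θ => Finset.sum_nonneg fun s _ => hC0 _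
  -- continuity, periodicity and rotation invariance of the weight
  have hFdef : ∀ φ : W r → ℝ, genF c φ =
      c.sum (fun n a => a * Complex.exp (Complex.I * ((∑ w, (n w : ℝ) * φ w : ℝ) : ℂ))) := fun φ => rfl
  have hHsum : ∀ θ : Λ L M → ℝ, H θ = (∑ s : Λ L M, genF c (fun w => θ (sh L M s w))).re := by
    intro θ; rw [hH, Complex.re_sum]
  have hcontA : Continuous fun θ : Λ L M → ℝ => ∑ s : Λ L M, genF c (fun w => θ (sh L M s w)) :=
    birAct_continuous_action c hFdef (sh L M)
  have hcontH : Continuous H := by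
    have : H = fun θ => (∑ s : Λ L M, genF c (fun w => θ (sh L M s w))).re := funext hHsum
    rw [this]; exact Complex.continuous_re.comp hcontA
  set Φ : (Λ L M → ℝ) → ℂ := fun θ => ((Real.exp (-(K * H θ)) : ℝ) : ℂ) with hΦ
  have hΦcont : Continuous Φ :=
    Complex.continuous_ofReal.comp (Real.continuous_exp.comp ((continuous_const.mul hcontH).neg))
  have hΦper : ∀ (θ : Λ L M → ℝ) (k : Λ L M → ℤ), Φ (fun i => θ i + k i • (2 * Real.pi)) = Φ θ := by
    intro θ k
    simp only [hΦ, hHsum]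
    rw [birAct_action_periodic c hFdef (sh L M) θ k]
  have hΦrot : ∀ (θ : Λ L M → ℝ) (α : ℝ), Φ (fun i => θ i + α) = Φ θ := by
    intro θ α
    simp only [hΦ, hHsum]
    rw [birAct_action_rotate c hU1 hFdef (sh L M) θ α]
  -- pin the rotation at the site `0`
  set ext : ({i : Λ L M // i ≠ 0} → ℝ) → Λ L M → ℝ :=
    fun δ i => if h : i = 0 then 0 else δ ⟨i, h⟩ with hext
  set big : Set ({i : Λ L M // i ≠ 0} → ℝ) := Set.pi univ (fun _ => Ioc (-Real.pi) Real.pi) with hbig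
  set f : ({i : Λ L M // i ≠ 0} → ℝ) → ℝ := fun δ => Real.exp (-(K * H (ext δ))) with hf
  have hshear := birFixedVolume_cube_to_shear (0 : Λ L M) hΦcont hΦper hΦrot
  have hreal : ∫ θ in cube L M, Real.exp (-(K * H θ)) = 2 * Real.pi * ∫ δ in big, f δ := by
    have h1 : (((∫ θ in cube L M, Real.exp (-(K * H θ))) : ℝ) : ℂ) = ∫ θ in cube L M, Φ θ := by
      rw [hΦ]; exact (integral_ofReal).symm
    have h2 : (((2 * Real.pi * ∫ δ in big, f δ) : ℝ) : ℂ) =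
        ((2 * Real.pi : ℝ) : ℂ) * ∫ δ in big, Φ (ext δ) := by
      rw [Complex.ofReal_mul, hΦ, hf]
      congr 1
      exact (integral_ofReal).symm
    apply Complex.ofReal_injective
    rw [h1, h2]
    exact hshear
  rw [hreal]
  -- the small box inside the sheared cube
  set ρ : ℝ := (Real.sqrt K)⁻¹ with hρ
  have hρpos : 0 < ρ := by rw [hρ]; exact inv_pos.mpr (Real.sqrt_pos.mpr hK0)
  have hρle1 : ρ ≤ 1 := by
    rw [hρ]; exact inv_le_one_of_one_le₀ (Real.one_le_sqrt.mpr hK)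
  have hρπ : ρ < Real.pi := lt_of_le_of_lt hρle1 (by linarith [Real.pi_gt_three])
  have hρsq : ρ ^ 2 = K⁻¹ := by
    rw [hρ, inv_pow, Real.sq_sqrt hK0.le]
  set box : Set ({i : Λ L M // i ≠ 0} → ℝ) := Set.pi univ (fun _ => Icc (-ρ) ρ) with hbox
  have hsub : box ⊆ big := by
    intro δ hδ
    simp only [hbox, hbig, Set.mem_univ_pi, Set.mem_Icc, Set.mem_Ioc] at hδ ⊢
    intro i; constructor <;> linarith [hδ i]
  have hfcont : Continuous f := by
    refine Real.continuous_exp.comp ((continuous_const.mul (hcontH.comp ?_)).neg)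
    exact birTorus_continuous_ext (0 : Λ L M)
  have hf01 : ∀ δ, 0 ≤ f δ ∧ f δ ≤ 1 := fun δ =>
    ⟨(Real.exp_pos _).le, Real.exp_le_one_iff.mpr (by nlinarith [hH0 (ext δ), hK0])⟩
  have hbig_fin : volume big < ⊤ := by
    rw [hbig, volume_pi_pi]
    simp only [Real.volume_Ioc, Finset.prod_const, Finset.card_univ]
    exact ENNReal.pow_lt_top ENNReal.ofReal_lt_top
  haveI : IsFiniteMeasure (volume.restrict big) := isFiniteMeasure_restrict.mpr hbig_fin.ne
  have hbox_meas : MeasurableSet box := MeasurableSet.univ_pi fun _ => measurableSet_Icc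
  have hfint_big : IntegrableOn f big := by
    refine (integrable_const (1:ℝ)).mono' hfcont.aestronglyMeasurable (ae_of_all _ fun δ => ?_)
    rw [Real.norm_eq_abs, abs_of_nonneg (hf01 δ).1]
    exact (hf01 δ).2
  -- volume of the box
  have hcard : Fintype.card {i : Λ L M // i ≠ 0} = Fintype.card (Λ L M) - 1 := by
    rw [Fintype.card_subtype_compl, Fintype.card_subtype_eq]
  have hbox_vol : volume.real box = (2 * ρ) ^ (Fintype.card (Λ L M) - 1) := by
    rw [measureReal_def, hbox, volume_pi_pi]
    simp only [Real.volume_Icc, Finset.prod_const, Finset.card_univ, hcard]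
    rw [ENNReal.toReal_pow, ENNReal.toReal_ofReal (by linarith)]
    ring
  have hbox_fin : volume box ≠ ⊤ := (lt_of_le_of_lt (measure_mono hsub) hbig_fin).ne
  -- the weight on the box
  have hfbox : ∀ δ ∈ box, Real.exp (-(3 * max B 0 * Fintype.card (Λ L M))) ≤ f δ := by
    intro δ hδ
    simp only [hbox, Set.mem_univ_pi, Set.mem_Icc] at hδ
    apply Real.exp_le_exp.mpr
    have hsmall : ∀ i, |ext δ i| ≤ ρ := by
      intro i
      simp only [hext]
      split_ifs with h
      · simp [hρpos.le]
      · exact abs_le.mpr (hδ _)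
    have h1 := ule_re_action_le_of_small c hU1 hN L M (ext δ) hsmall
    rw [← hHsum] at h1
    have hN0 : (0 : ℝ) ≤ Fintype.card (Λ L M) := by positivity
    have hnA : 0 ≤ normA c := normA_nonneg c
    have h2 : K * H (ext δ) ≤ 3 * max B 0 * Fintype.card (Λ L M) := by
      calc K * H (ext δ) ≤ K * (3 * normA c * ρ ^ 2 * Fintype.card (Λ L M)) :=
            mul_le_mul_of_nonneg_left h1 hK0.le
        _ = 3 * normA c * Fintype.card (Λ L M) := by
            rw [hρsq]; field_simp
        _ ≤ 3 * max B 0 * Fintype.card (Λ L M) := by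
            gcongr; exact hA.trans (le_max_left _ _)
    linarith
  -- assemble
  have hI1 : Real.exp (-(3 * max B 0 * Fintype.card (Λ L M))) * volume.real box ≤ ∫ δ in box, f δ :=
    setIntegral_ge_of_const_le_real hbox_meas hbox_fin hfbox (hfint_big.mono_set hsub)
  have hI2 : ∫ δ in box, f δ ≤ ∫ δ in big, f δ :=
    setIntegral_mono_set hfint_big (ae_of_all _ fun δ => (hf01 δ).1) (ae_of_all _ hsub)
  have h2π : (0 : ℝ) ≤ 2 * Real.pi := by positivity
  calc 2 * Real.pi * (2 * (Real.sqrt K)⁻¹) ^ (Fintype.card (Λ L M) - 1) *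
        Real.exp (-(3 * max B 0 * Fintype.card (Λ L M)))
      = 2 * Real.pi * (Real.exp (-(3 * max B 0 * Fintype.card (Λ L M))) * volume.real box) := by
        rw [hbox_vol, hρ]; ring
    _ ≤ 2 * Real.pi * ∫ δ in big, f δ := mul_le_mul_of_nonneg_left (hI1.trans hI2) h2π

end Lower

section LowerStub

open Summit.HubbardSuperconductivity.BirComplexStableXYNegative Literature.Probability.LatticeModels

/-- **Registered form of `ule_partZ_lower`** (binder-free, for the crux stub registry). [folklore] -/
theorem ule_partZ_lowerBound :
    ∀ (r : ℕ) (c : Table r), (∀ n ∈ c.support, ∑ w, n w = 0) → c.sum (fun _ a => a) = 0 → ∀ (B : ℝ), normA c ≤ B → (∀ φ : W r → ℝ, 0 ≤ (genF c φ).re) → ∀ (K : ℝ), 1 ≤ K → ∀ (L M : ℕ) [NeZero L] [NeZero M], 2 * Real.pi * (2 * (Real.sqrt K)⁻¹) ^ (Fintype.card (Λ L M) - 1) * Real.exp (-(3 * max B 0 * Fintype.card (Λ L M))) ≤ ∫ θ in cube L M, Real.exp (-(K * ∑ s : Λ L M, (genF c (fun w => θ (sh L M s w))).re)) :=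
  fun _ c hU1 hN _ hA hC0 _ hK L M _ _ => ule_partZ_lower c hU1 hN hA hC0 hK L M

end LowerStub

end Summit.HubbardSuperconductivity.HubbardSuperconductivity.Theorems

end
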